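/-
Copyright (c) 2026. All rights reserved.
Released under Apache 2.0 license as described in the file LICENSE.
Authors: abc-iut cell, campaign-S prover seat abc-iut-S5 (wave 2).
-/
import Mathlib.RingTheory.DedekindDomain.Different
import Mathlib.RingTheory.Localization.Module
import Literature.IUT.LogVolume.IntegerRingFinite
import HarnessLib

/-!
# Integral bases, trace-dual bases and the different of a mixed-characteristic local field ([IUTchIV] §1)

Mochizuki, *Inter-universal Teichmüller theory IV*, RIMS manuscript (Apr. 2020), §1, Proposition 1.1,
kurims p. 9 ("`R_i := 𝒪_{k_i}` … `d_i` … the order of any generator of the different ideal of `R_i` over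
`ℤ_p`") and its proof, p. 10 l. 7 ("the desired inclusion follows immediately from the definition of the
different ideal").  Single-field infrastructure for the discharge of Prop. 1.1 (`PacketDifferent.lean`),
over the cell's norm-side MLF setting and the REAL definitions of `IntegerRing.lean` /
`IntegerRingFinite.lean` (`different p K = differentIdeal ℤ_[p] 𝒪_K`):

* `exists_integralBasis` — `𝒪_K` has a `ℤ_p`-basis which is a `ℚ_p`-basis of `K`; in it, integrality is
  read off the coordinates (`repr_eq_of_norm_le_one`, `norm_repr_le_one`, `norm_le_one_of_norm_repr_le`);
* `exists_traceDual_basis` — trace-dual bases exist (`Tr_{K/ℚ_p}` non-degenerate, `K/ℚ_p` separable);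
* `norm_mul_le_one_of_traceDual` — **"the definition of the different ideal"**: for the trace-dual basis
  `c` of an integral basis and a generator `δ` of `𝔇_{K/ℚ_p}`, `δ·c_j ∈ 𝒪_K` (the trace dual of `𝒪_K`
  is `𝔇⁻¹ = δ⁻¹𝒪_K`; Mathlib `coeIdeal_differentIdeal`).

Classical (Serre, *Local Fields*, Ch. III §3); the tags record the cell's typing of [IUTchIV].
-/

noncomputable section

open Metric Set Function Module
open scoped Pointwise NormedField nonZeroDivisors

namespace Literature.IUT.LogVolume


/-! ## Integral bases of a single field -/

section IntegralBasis

variable {p : ℕ} [Fact p.Prime]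
variable (K : Type*) [NontriviallyNormedField K] [NormedAlgebra ℚ_[p] K] [IsUltrametricDist K]
  [ProperSpace K]

/-- **Integral bases exist**: `𝒪_K` has a `ℤ_p`-basis, and it is a `ℚ_p`-basis of `K`
(`𝒪_K` free of rank `[K:ℚ_p]`, `IntegerRingFinite.lean`). [claim: Mochizuki2012, status: disputed] -/
theorem exists_integralBasis :
    ∃ (n : ℕ) (bZ : Basis (Fin n) ℤ_[p] (Valued.integer K)) (bQ : Basis (Fin n) ℚ_[p] K),
      ∀ j, bQ j = (bZ j : K) := by
  haveI := finiteDimensional p K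
  haveI : Algebra.IsAlgebraic ℚ_[p] K := Algebra.IsAlgebraic.of_finite ℚ_[p] K
  haveI : IsLocalization (Algebra.algebraMapSubmonoid (Valued.integer K) (nonZeroDivisors ℤ_[p])) K :=
    IsIntegralClosure.isLocalization ℤ_[p] ℚ_[p] K (Valued.integer K)
  let bZ := Module.finBasis ℤ_[p] (Valued.integer K)
  refine ⟨_, bZ, bZ.localizationLocalization ℚ_[p] (nonZeroDivisors ℤ_[p]) K, fun j => ?_⟩
  rw [Basis.localizationLocalization_apply]
  rfl

variable {K}
variable {κ : Type*} [Fintype κ] (bZ : Basis κ ℤ_[p] (Valued.integer K)) (bQ : Basis κ ℚ_[p] K)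
  (hb : ∀ j, bQ j = (bZ j : K))
include hb

omit [ProperSpace K] in
/-- In an integral basis, an integer has `ℤ_p`-coordinates. [claim: Mochizuki2012, status: disputed] -/
theorem repr_eq_of_norm_le_one {x : K} (hx : ‖x‖ ≤ 1) (j : κ) :
    bQ.repr x j = ((bZ.repr ⟨x, Valued.integer.mem_iff.mpr hx⟩ j : ℤ_[p]) : ℚ_[p]) := by
  set x' : Valued.integer K := ⟨x, Valued.integer.mem_iff.mpr hx⟩
  have hx' : x = ∑ i, ((bZ.repr x' i : ℤ_[p]) : ℚ_[p]) • bQ i := by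
    have h := congrArg (fun y : Valued.integer K => (y : K)) (bZ.sum_repr x')
    simp only [AddSubmonoidClass.coe_finsetSum] at h
    conv_lhs => rw [show x = (x' : K) from rfl, ← h]
    refine Finset.sum_congr rfl fun i _ => ?_
    rw [hb, Algebra.smul_def, Algebra.smul_def, MulMemClass.coe_mul, algebraMap_integer_eq,
      coe_integerHom]
  rw [hx', bQ.repr_sum_self]

omit [ProperSpace K] in
/-- In an integral basis, integers have coordinates of norm `≤ 1`. [claim: Mochizuki2012, status: disputed] -/
theorem norm_repr_le_one {x : K} (hx : ‖x‖ ≤ 1) (j : κ) : ‖bQ.repr x j‖ ≤ 1 := by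
  rw [repr_eq_of_norm_le_one bZ bQ hb hx j]
  exact PadicInt.norm_le_one _

omit [ProperSpace K] in
/-- Conversely, coordinates of norm `≤ 1` give an integer. [claim: Mochizuki2012, status: disputed] -/
theorem norm_le_one_of_norm_repr_le {x : K} (h : ∀ j, ‖bQ.repr x j‖ ≤ 1) : ‖x‖ ≤ 1 := by
  rw [← bQ.sum_repr x]
  refine IsUltrametricDist.norm_sum_le_of_forall_le_of_nonneg zero_le_one fun j _ => ?_
  rw [norm_smul, hb]
  exact mul_le_one₀ (h j) (norm_nonneg _) (Valued.integer.norm_le_one (bZ j))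

omit [ProperSpace K] [Fintype κ] in
/-- Basis vectors of an integral basis are integers. [claim: Mochizuki2012, status: disputed] -/
theorem norm_basis_le_one (j : κ) : ‖bQ j‖ ≤ 1 := by
  rw [hb]; exact Valued.integer.norm_le_one (bZ j)

end IntegralBasis

/-! ## Dual bases and the different (one field) -/

section DualBasis

variable {p : ℕ} [Fact p.Prime]
variable {K : Type*} [NontriviallyNormedField K] [NormedAlgebra ℚ_[p] K] [IsUltrametricDist K]
  [ProperSpace K]

/-- **Trace-dual bases exist**: for a `ℚ_p`-basis `b` of `K` there is a basis `c` with
`Tr_{K/ℚ_p}(c_i b_j) = δ_{ij}` (the trace form of the separable extension `K/ℚ_p` is non-degenerate).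
[claim: Mochizuki2012, status: disputed] -/
theorem exists_traceDual_basis {κ : Type*} [Fintype κ] [DecidableEq κ] (bQ : Basis κ ℚ_[p] K) :
    ∃ cQ : Basis κ ℚ_[p] K, ∀ i j, Algebra.trace ℚ_[p] K (cQ i * bQ j) = if j = i then 1 else 0 := by
  haveI := finiteDimensional p K
  refine ⟨(Algebra.traceForm ℚ_[p] K).dualBasis (traceForm_nondegenerate ℚ_[p] K) bQ, fun i j => ?_⟩
  rw [← Algebra.traceForm_apply]
  exact LinearMap.BilinForm.apply_dualBasis_left _ _ i j

/-- **`δ · c_i ∈ R` for the trace-dual basis `c` of an integral basis and a generator `δ` of the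
different** ("the definition of the different ideal", [IUTchIV] p. 10 l. 7: the trace dual of `R = 𝒪_K`
is `𝔇⁻¹ = δ⁻¹R`; Mathlib `coeIdeal_differentIdeal`). [claim: Mochizuki2012, status: disputed] -/
theorem norm_mul_le_one_of_traceDual {κ : Type*} [Fintype κ] [DecidableEq κ]
    (bZ : Basis κ ℤ_[p] (Valued.integer K))
    (bQ : Basis κ ℚ_[p] K) (hb : ∀ j, bQ j = (bZ j : K)) (cQ : Basis κ ℚ_[p] K)
    (hc : ∀ i j, Algebra.trace ℚ_[p] K (cQ i * bQ j) = if j = i then 1 else 0)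
    {δ : Valued.integer K} (hδ : different p K = Ideal.span {δ}) (i : κ) :
    ‖(δ : K) * cQ i‖ ≤ 1 := by
  classical
  haveI := finiteDimensional p K
  -- `c_i` lies in the trace dual of `R`
  have h10 : (1 : FractionalIdeal (Valued.integer K)⁰ K) ≠ 0 := one_ne_zero
  have hmem : cQ i ∈ FractionalIdeal.dual ℤ_[p] ℚ_[p] (1 : FractionalIdeal (Valued.integer K)⁰ K) := by
    rw [FractionalIdeal.mem_dual h10]
    intro a ha
    obtain ⟨a', rfl⟩ := (FractionalIdeal.mem_one_iff (S := (Valued.integer K)⁰)).mp ha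
    have ha' : algebraMap (Valued.integer K) K a' = ∑ j, ((bZ.repr a' j : ℤ_[p]) : ℚ_[p]) • bQ j := by
      have h := congrArg (fun y : Valued.integer K => (y : K)) (bZ.sum_repr a')
      simp only [AddSubmonoidClass.coe_finsetSum] at h
      rw [show algebraMap (Valued.integer K) K a' = (a' : K) from rfl, ← h]
      refine Finset.sum_congr rfl fun j _ => ?_
      rw [hb, Algebra.smul_def, Algebra.smul_def, MulMemClass.coe_mul, algebraMap_integer_eq,
        coe_integerHom]
    rw [Algebra.traceForm_apply, ha', Finset.mul_sum, map_sum]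
    have hterm : ∀ j, Algebra.trace ℚ_[p] K (cQ i * (((bZ.repr a' j : ℤ_[p]) : ℚ_[p]) • bQ j)) =
        if j = i then ((bZ.repr a' j : ℤ_[p]) : ℚ_[p]) else 0 := by
      intro j
      rw [mul_smul_comm, LinearMap.map_smul, hc, smul_eq_mul, mul_ite, mul_one, mul_zero]
    rw [Finset.sum_congr rfl (fun j _ => hterm j), Finset.sum_ite_eq' Finset.univ i,
      if_pos (Finset.mem_univ i)]
    exact ⟨bZ.repr a' i, rfl⟩
  -- the dual of `R` is `δ⁻¹ R`
  have hdual : FractionalIdeal.dual ℤ_[p] ℚ_[p] (1 : FractionalIdeal (Valued.integer K)⁰ K) =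
      FractionalIdeal.spanSingleton (Valued.integer K)⁰ ((δ : K)⁻¹) := by
    have h := coeIdeal_differentIdeal ℤ_[p] ℚ_[p] K (Valued.integer K)
    rw [← different_eq, hδ, FractionalIdeal.coeIdeal_span_singleton] at h
    rw [← inv_inv (FractionalIdeal.dual ℤ_[p] ℚ_[p] _), ← h, FractionalIdeal.spanSingleton_inv]
    rfl
  rw [hdual, FractionalIdeal.mem_spanSingleton] at hmem
  obtain ⟨z, hz⟩ := hmem
  have hδ0 : (δ : K) ≠ 0 := by
    have := generator_ne_zero p K hδ
    exact_mod_cast this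
  have hz' : (δ : K) * cQ i = z := by
    rw [← hz, Algebra.smul_def, mul_left_comm, mul_inv_cancel₀ hδ0, mul_one]
    rfl
  rw [hz']
  exact Valued.integer.norm_le_one z

end DualBasis

end Literature.IUT.LogVolume

end
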